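import Literature.Geometry.Kaehler.ComplexTorusLaplacianSpectrum
import HarnessLib

/-!
# Flat tori isospectral on `p`-forms: Miatello–Rossetti's Theorem 3.1 criterion and Remarks 3.2–3.3
# for tori

R. J. Miatello, J. P. Rossetti, *Flat manifolds isospectral on `p`-forms*, J. Geom. Anal. **11**
(2001) 649–667, held `paper:arxiv-math_0303276`, p0004 L8–L19, VERBATIM: "**Theorem 3.1** If `Γ` is a
Bieberbach group with holonomy group `F`, for each `μ ≥ 0` and `0 ≤ p ≤ n`, the multiplicity of the
eigenvalue `4π²μ` of `-Δ_p` is given by `d_{p,μ}(Γ) = |F|⁻¹ ∑_{B ∈ F} tr_p(B) e_{μ,B}(Γ)`. (3.1)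
Let `Γ` and `Γ'` be Bieberbach groups with holonomy groups `F` and `F'` and translation lattice `Λ`.
Let `0 ≤ p ≤ n`. If there is a bijection `Φ : B ↔ B'` from `F` onto `F'` such that, for each `μ, B`,
`tr_p(B) e_{μ,B}(Γ) = tr_p(B') e_{μ,B'}(Γ')` then `M_Γ` and `M_{Γ'}` are isospectral on `p`-forms.";
p0004 L22–L26: "**Remark 3.2** In the notation of Theorem 3.1 we see that if the bijection `Φ`
preserves `tr_p`, then `0`-isospectral implies `p`-isospectral. In particular this is always the case
if `F = F'` and if one can take `Φ = I`, then `0`-isospectral implies `p`-isospectral for all `p`. On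
the other hand, we shall see that `p`-isospectral need not imply `0`-isospectral."; p0004 L28–L31:
"**Remark 3.3** If `B ∈ O(n)` then `tr_p(B) = det(B) tr_{n-p}(B)`, hence (3.1) implies the well known
fact that if `M_Γ` is orientable then `d_{p,μ} = d_{n-p,μ}` for all `μ ∈ ℕ₀`"; and §3, p0003
L33–L36: "The spectrum of `-Δ` in `Λ\ℝⁿ` is thus determined by the cardinality of the sets `Λ*_μ`."
[cite: MiatelloRossetti2001, Thm. 3.1 and Remarks 3.2–3.3 (p0004)]

Here for the TORUS ITSELF — `Γ = Λ`, `F = F' = {1}`, `tr_p(1) = C(n,p)`, `e_{μ,1}(Λ) = #Λ*_μ` — on the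
carrier of `ComplexTorusLaplacianSpectrum.lean` (lane `lit-hodgefound`, row Q528, prover seat p14),
of which this file is the sequel: `X = ComplexTorus Φ = E/Φ(ℤ^ι)` with a translation-invariant
Riemannian metric `g` (`hg`) and an orientation family `o` with smooth volume form (`ho`), C12's
`cHodgeLaplacian o k m h` on smooth COMPLEX `k`-forms (MINUS Miatello–Rossetti's `Δ_p`), the dual
lattice read through `w ∈ ℤ^ι ↦ v_w` (`existsUnique_dualLatticeVec`:
`g₀(v_w, y) = ∑ₐ wₐ xₐ(y)`), so that
`Λ*_μ(X) = {w ∈ ℤ^ι : ‖v_w‖² = μ}` (finite, `finite_setOf_dualLatticeVec_norm_sq_eq`; counted here by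
`Set.ncard`), and **the multiplicity `d_{k,μ}(X)`** = `finrank ℂ` of the `ℂ`-span of the smooth complex
`k`-forms `β` with `Δβ = 4π²μ β` (the `4π²μ`-eigenspace; the span adds nothing, the eigenforms being a
subspace, `mem_span_mFourier_smul_constForm_iff`). By Q528 §8
(`exists_dualLatticeVec_eq_of_cHodgeLaplacian_eq_smul`) the spectrum of `Δ` on `k`-forms is
`{4π²‖v‖² : v ∈ Λ*}` with these multiplicities, so "`X` and `X'` are isospectral on `k`-forms" IS
"`d_{k,μ}(X) = d_{k,μ}(X')` for every `μ ∈ ℝ`", which is how it is written below.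

## Contents (theorems only; no `def`, no named fact)

* `finrank_span_eigenforms_eq_ncard_mul_choose` — **Theorem 3.1 for the torus**:
  `d_{k,μ}(X) = #Λ*_μ(X) · C(n,k)`, `n = dim_ℝ X`, for every `μ ∈ ℝ` (repackaging of Q528's
  `finrank_span_mFourier_smul_constForm` + `mem_span_mFourier_smul_constForm_iff` on the eigenspace
  itself, no auxiliary finite set of frequencies);
  `finrank_span_eigenforms_zero_eq_ncard` (`d_{0,μ} = #Λ*_μ`: "the spectrum of `-Δ` in `Λ\ℝⁿ` is thus
  determined by the cardinality of the sets `Λ*_μ`").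
* `finrank_span_eigenforms_eq_of_ncard_eq` — **the isospectrality criterion of Theorem 3.1 for two
  flat tori** `X = (ComplexTorus Φ, g, o)`, `X' = (ComplexTorus Φ', g', o')` of the same dimension `n`
  (different `E, E', ι, ι'` allowed): `#Λ*_μ(X) = #Λ*_μ(X')` for all `μ` ⇒ `d_{k,μ}(X) = d_{k,μ}(X')`
  for all `k, μ`.
* `ncard_eq_of_finrank_span_eigenforms_eq`, `finrank_span_eigenforms_eq_of_finrank_span_eigenforms_eq`
  — **Remark 3.2 for tori** (`F = F' = {1}`, `Φ = I`): `k₀`-isospectral for ONE degree `k₀ ≤ n`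
  (`C(n,k₀) ≠ 0`; in particular `k₀ = 0`) ⇒ `#Λ*_μ` agree ⇒ `k`-isospectral for ALL `k` (for tori the
  converse direction holds too; MR's "`p`-isospectral need not imply `0`-isospectral" concerns
  `F ≠ {1}` and is not asserted).
* `finrank_span_eigenforms_eq_finrank_span_eigenforms_of_add_eq` — **Remark 3.3 for the torus**:
  `d_{k,μ} = d_{n-k,μ}` (`C(n,k) = C(n,n-k)`).
* `ncard_dualLattice_norm_sq_zero`, `finrank_span_eigenforms_zero_right` — validation at `μ = 0`:
  `Λ*_0 = {0}` (`dualLatticeVec_norm_sq_eq_zero_iff`), so `d_{k,0} = C(n,k)` (`= dim IF^k(X)`, the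
  harmonic = invariant forms, junction with `ComplexTorusHarmonicForms.lean`).

NOT here: Bieberbach groups with non-trivial holonomy (the sums `e_{μ,B}`, `tr_p(B)`), the examples
of §§4–5, Milnor's isospectral non-isometric tori.

## References
* [cite: MiatelloRossetti2001, Thm. 3.1 and Remarks 3.2–3.3 (p0004)] R. J. Miatello, J. P. Rossetti,
  *Flat manifolds isospectral on `p`-forms*, J. Geom. Anal. 11 (2001) 649–667, doi:10.1007/bf02930761.
* [cite: GallotHulinLafontaine2004, §4.E.2] S. Gallot, D. Hulin, J. Lafontaine, *Riemannian
  Geometry*, 3rd ed. (2004), §4.E.2 (spectrum of flat tori).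
-/

noncomputable section

open scoped Manifold ContDiff Topology InnerProductSpace
open Bundle Module Function UnitAddTorus
open Literature.NumberTheory.Transcendental Literature.Analysis.FunctionSpaces

namespace Literature.Geometry.Kaehler

namespace ComplexTorus

variable {ι : Type*} [Fintype ι] {E : Type*} [NormedAddCommGroup E] [NormedSpace ℂ E]
  [FiniteDimensional ℂ E] (Φ : (ι → ℝ) ≃L[ℝ] E) {n : ℕ} [Fact (finrank ℝ E = n)]
  (g : ContMDiffRiemannianMetric 𝓘(ℝ, E) ∞ E (fun x : ComplexTorus Φ ↦ TangentSpace 𝓘(ℝ, E) x))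
  (o : (x : ComplexTorus Φ) → Orientation ℝ (TangentSpace 𝓘(ℝ, E) x) (Fin n)) {k m : ℕ}

/-! ### §1 Theorem 3.1 for the torus: `d_{k,μ}(X) = #Λ*_μ(X) · C(n,k)` -/

/-- **Theorem 3.1 for the flat torus: the multiplicity of the eigenvalue `4π²μ` on `k`-forms is
`d_{k,μ}(X) = #Λ*_μ · C(n,k)`** (`Γ = Λ`, `F = {1}`, `tr_k(1) = C(n,k)`, `e_{μ,1}(Λ) = #Λ*_μ`): for every
`μ ∈ ℝ`, the `ℂ`-span of the smooth complex `k`-forms `β` on `(X, g, o)` with `Δβ = 4π²μ β` has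
dimension `#{w ∈ ℤ^ι : ‖v_w‖² = μ} · C(n,k)`, `n = dim_ℝ X` (from Q528's
`finrank_span_mFourier_smul_constForm` and `mem_span_mFourier_smul_constForm_iff`).
[cite: MiatelloRossetti2001, Thm. 3.1 (p0004 L8–L12)] -/
theorem finrank_span_eigenforms_eq_ncard_mul_choose (hg : ∀ x y, g.inner x = g.inner y)
    (ho : letI : RiemannianBundle (fun x : ComplexTorus Φ ↦ TangentSpace 𝓘(ℝ, E) x) :=
        ⟨g.toRiemannianMetric⟩
      IsSmoothForm (riemannianVolumeForm o)) (h : k + m = n) (μ : ℝ) :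
    letI : RiemannianBundle (fun x : ComplexTorus Φ ↦ TangentSpace 𝓘(ℝ, E) x) :=
      ⟨g.toRiemannianMetric⟩
    finrank ℂ (Submodule.span ℂ {β : MForm 𝓘(ℝ, E) (ComplexTorus Φ) ℂ k |
        IsSmoothForm β ∧ cHodgeLaplacian o k m h β = ((4 * Real.pi ^ 2 * μ : ℝ) : ℂ) • β}) =
      Set.ncard {w : ι → ℤ | ∃ v : TangentSpace 𝓘(ℝ, E) (0 : ComplexTorus Φ),
        (∀ y : TangentSpace 𝓘(ℝ, E) (0 : ComplexTorus Φ), ⟪v, y⟫_ℝ = ∑ a, (w a : ℝ) * Φ.symm y a) ∧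
          ‖v‖ ^ 2 = μ} * n.choose k := by
  letI : RiemannianBundle (fun x : ComplexTorus Φ ↦ TangentSpace 𝓘(ℝ, E) x) :=
    ⟨g.toRiemannianMetric⟩
  classical
  have hfin := finite_setOf_dualLatticeVec_norm_sq_eq Φ g μ
  set S : Finset (ι → ℤ) := hfin.toFinset with hS_def
  have hS : ∀ w : ι → ℤ, w ∈ S ↔ ∃ v : TangentSpace 𝓘(ℝ, E) (0 : ComplexTorus Φ),
      (∀ y : TangentSpace 𝓘(ℝ, E) (0 : ComplexTorus Φ), ⟪v, y⟫_ℝ = ∑ a, (w a : ℝ) * Φ.symm y a) ∧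
        ‖v‖ ^ 2 = μ := fun w ↦ hfin.mem_toFinset
  -- the eigenspace is the span of the `e_w • c`, `w ∈ Λ*_μ`
  have hspan : Submodule.span ℂ {β : MForm 𝓘(ℝ, E) (ComplexTorus Φ) ℂ k |
      IsSmoothForm β ∧ cHodgeLaplacian o k m h β = ((4 * Real.pi ^ 2 * μ : ℝ) : ℂ) • β} =
      Submodule.span ℂ {β : MForm 𝓘(ℝ, E) (ComplexTorus Φ) ℂ k |
        ∃ w ∈ S, ∃ c : E [⋀^Fin k]→L[ℝ] ℂ,
          β = fun x : ComplexTorus Φ ↦ (mFourier w x : ℂ) • constForm Φ c x} := by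
    apply le_antisymm
    · rw [Submodule.span_le]
      intro β hβ
      exact (mem_span_mFourier_smul_constForm_iff Φ g o hg ho h S hS β).2 hβ
    · rw [Submodule.span_le]
      intro β hβ
      exact Submodule.subset_span
        ((mem_span_mFourier_smul_constForm_iff Φ g o hg ho h S hS β).1 (Submodule.subset_span hβ))
  rw [hspan, finrank_span_mFourier_smul_constForm (n := n) (k := k) Φ S,
    Set.ncard_eq_toFinset_card _ hfin]

/-- **`d_{0,μ}(X) = #Λ*_μ`: on functions the multiplicity of `4π²μ` is the number of dual-lattice
vectors of square norm `μ`** — "The spectrum of `-Δ` in `Λ\ℝⁿ` is thus determined by the cardinality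
of the sets `Λ*_μ`." [cite: MiatelloRossetti2001, §3 (p0003 L33–L36)]
[cite: GallotHulinLafontaine2004, §4.E.2 (p0199 L7–L9)] -/
theorem finrank_span_eigenforms_zero_eq_ncard (hg : ∀ x y, g.inner x = g.inner y)
    (ho : letI : RiemannianBundle (fun x : ComplexTorus Φ ↦ TangentSpace 𝓘(ℝ, E) x) :=
        ⟨g.toRiemannianMetric⟩
      IsSmoothForm (riemannianVolumeForm o)) (h : 0 + m = n) (μ : ℝ) :
    letI : RiemannianBundle (fun x : ComplexTorus Φ ↦ TangentSpace 𝓘(ℝ, E) x) :=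
      ⟨g.toRiemannianMetric⟩
    finrank ℂ (Submodule.span ℂ {β : MForm 𝓘(ℝ, E) (ComplexTorus Φ) ℂ 0 |
        IsSmoothForm β ∧ cHodgeLaplacian o 0 m h β = ((4 * Real.pi ^ 2 * μ : ℝ) : ℂ) • β}) =
      Set.ncard {w : ι → ℤ | ∃ v : TangentSpace 𝓘(ℝ, E) (0 : ComplexTorus Φ),
        (∀ y : TangentSpace 𝓘(ℝ, E) (0 : ComplexTorus Φ), ⟪v, y⟫_ℝ = ∑ a, (w a : ℝ) * Φ.symm y a) ∧
          ‖v‖ ^ 2 = μ} := by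
  rw [finrank_span_eigenforms_eq_ncard_mul_choose Φ g o hg ho h μ, Nat.choose_zero_right, mul_one]

/-! ### §2 The isospectrality criterion of Theorem 3.1 and Remark 3.2, for two flat tori -/

section TwoTori

variable {ι' : Type*} [Fintype ι'] {E' : Type*} [NormedAddCommGroup E'] [NormedSpace ℂ E']
  [FiniteDimensional ℂ E'] (Φ' : (ι' → ℝ) ≃L[ℝ] E') [Fact (finrank ℝ E' = n)]
  (g' : ContMDiffRiemannianMetric 𝓘(ℝ, E') ∞ E' (fun x : ComplexTorus Φ' ↦ TangentSpace 𝓘(ℝ, E') x))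
  (o' : (x : ComplexTorus Φ') → Orientation ℝ (TangentSpace 𝓘(ℝ, E') x) (Fin n))

/-- **Theorem 3.1's criterion for two flat tori: equal numbers of dual-lattice vectors of each
length ⇒ isospectral on `k`-forms, every `k`.** Let `X = (E/Φ(ℤ^ι), g, o)` and
`X' = (E'/Φ'(ℤ^{ι'}), g', o')` be flat tori of the same dimension `n` with
`#Λ*_μ(X) = #Λ*_μ(X')` for every `μ` ("a bijection … such that, for each `μ`,
`tr_p(1) e_{μ,1}(Λ) = tr_p(1) e_{μ,1}(Λ')`"). Then for every degree `k` and every `μ` the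
multiplicities of `4π²μ` agree, `d_{k,μ}(X) = d_{k,μ}(X')` — "`M_Γ` and `M_{Γ'}` are isospectral on
`p`-forms". [cite: MiatelloRossetti2001, Thm. 3.1 (p0004 L13–L19)] -/
theorem finrank_span_eigenforms_eq_of_ncard_eq (hg : ∀ x y, g.inner x = g.inner y)
    (ho : letI : RiemannianBundle (fun x : ComplexTorus Φ ↦ TangentSpace 𝓘(ℝ, E) x) :=
        ⟨g.toRiemannianMetric⟩
      IsSmoothForm (riemannianVolumeForm o))
    (hg' : ∀ x y, g'.inner x = g'.inner y)
    (ho' : letI : RiemannianBundle (fun x : ComplexTorus Φ' ↦ TangentSpace 𝓘(ℝ, E') x) :=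
        ⟨g'.toRiemannianMetric⟩
      IsSmoothForm (riemannianVolumeForm o')) (h : k + m = n)
    (hΛ : letI : RiemannianBundle (fun x : ComplexTorus Φ ↦ TangentSpace 𝓘(ℝ, E) x) :=
        ⟨g.toRiemannianMetric⟩
      letI : RiemannianBundle (fun x : ComplexTorus Φ' ↦ TangentSpace 𝓘(ℝ, E') x) :=
        ⟨g'.toRiemannianMetric⟩
      ∀ μ : ℝ,
        Set.ncard {w : ι → ℤ | ∃ v : TangentSpace 𝓘(ℝ, E) (0 : ComplexTorus Φ),
          (∀ y : TangentSpace 𝓘(ℝ, E) (0 : ComplexTorus Φ), ⟪v, y⟫_ℝ = ∑ a, (w a : ℝ) * Φ.symm y a) ∧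
            ‖v‖ ^ 2 = μ} =
        Set.ncard {w' : ι' → ℤ | ∃ v' : TangentSpace 𝓘(ℝ, E') (0 : ComplexTorus Φ'),
          (∀ y : TangentSpace 𝓘(ℝ, E') (0 : ComplexTorus Φ'),
              ⟪v', y⟫_ℝ = ∑ a, (w' a : ℝ) * Φ'.symm y a) ∧ ‖v'‖ ^ 2 = μ})
    (μ : ℝ) :
    letI : RiemannianBundle (fun x : ComplexTorus Φ ↦ TangentSpace 𝓘(ℝ, E) x) :=
      ⟨g.toRiemannianMetric⟩
    letI : RiemannianBundle (fun x : ComplexTorus Φ' ↦ TangentSpace 𝓘(ℝ, E') x) :=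
      ⟨g'.toRiemannianMetric⟩
    finrank ℂ (Submodule.span ℂ {β : MForm 𝓘(ℝ, E) (ComplexTorus Φ) ℂ k |
        IsSmoothForm β ∧ cHodgeLaplacian o k m h β = ((4 * Real.pi ^ 2 * μ : ℝ) : ℂ) • β}) =
      finrank ℂ (Submodule.span ℂ {β' : MForm 𝓘(ℝ, E') (ComplexTorus Φ') ℂ k |
        IsSmoothForm β' ∧ cHodgeLaplacian o' k m h β' = ((4 * Real.pi ^ 2 * μ : ℝ) : ℂ) • β'}) := by
  rw [finrank_span_eigenforms_eq_ncard_mul_choose Φ g o hg ho h μ,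
    finrank_span_eigenforms_eq_ncard_mul_choose Φ' g' o' hg' ho' h μ, hΛ μ]

/-- **Conversely (tori only): isospectral on `k₀`-forms for ONE degree `k₀ ≤ n` forces
`#Λ*_μ(X) = #Λ*_μ(X')` for every `μ`** — since `d_{k₀,μ} = #Λ*_μ · C(n,k₀)` with `C(n,k₀) ≠ 0`
(Theorem 3.1 with `F = {1}`). The degree is `k₀ = k` with `k + m = n`.
[cite: MiatelloRossetti2001, Thm. 3.1 and Remark 3.2 (p0004)] -/
theorem ncard_eq_of_finrank_span_eigenforms_eq (hg : ∀ x y, g.inner x = g.inner y)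
    (ho : letI : RiemannianBundle (fun x : ComplexTorus Φ ↦ TangentSpace 𝓘(ℝ, E) x) :=
        ⟨g.toRiemannianMetric⟩
      IsSmoothForm (riemannianVolumeForm o))
    (hg' : ∀ x y, g'.inner x = g'.inner y)
    (ho' : letI : RiemannianBundle (fun x : ComplexTorus Φ' ↦ TangentSpace 𝓘(ℝ, E') x) :=
        ⟨g'.toRiemannianMetric⟩
      IsSmoothForm (riemannianVolumeForm o')) (h : k + m = n)
    (hiso : letI : RiemannianBundle (fun x : ComplexTorus Φ ↦ TangentSpace 𝓘(ℝ, E) x) :=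
        ⟨g.toRiemannianMetric⟩
      letI : RiemannianBundle (fun x : ComplexTorus Φ' ↦ TangentSpace 𝓘(ℝ, E') x) :=
        ⟨g'.toRiemannianMetric⟩
      ∀ μ : ℝ,
        finrank ℂ (Submodule.span ℂ {β : MForm 𝓘(ℝ, E) (ComplexTorus Φ) ℂ k |
            IsSmoothForm β ∧ cHodgeLaplacian o k m h β = ((4 * Real.pi ^ 2 * μ : ℝ) : ℂ) • β}) =
          finrank ℂ (Submodule.span ℂ {β' : MForm 𝓘(ℝ, E') (ComplexTorus Φ') ℂ k |
            IsSmoothForm β' ∧ cHodgeLaplacian o' k m h β' = ((4 * Real.pi ^ 2 * μ : ℝ) : ℂ) • β'}))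
    (μ : ℝ) :
    letI : RiemannianBundle (fun x : ComplexTorus Φ ↦ TangentSpace 𝓘(ℝ, E) x) :=
      ⟨g.toRiemannianMetric⟩
    letI : RiemannianBundle (fun x : ComplexTorus Φ' ↦ TangentSpace 𝓘(ℝ, E') x) :=
      ⟨g'.toRiemannianMetric⟩
    Set.ncard {w : ι → ℤ | ∃ v : TangentSpace 𝓘(ℝ, E) (0 : ComplexTorus Φ),
        (∀ y : TangentSpace 𝓘(ℝ, E) (0 : ComplexTorus Φ), ⟪v, y⟫_ℝ = ∑ a, (w a : ℝ) * Φ.symm y a) ∧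
          ‖v‖ ^ 2 = μ} =
      Set.ncard {w' : ι' → ℤ | ∃ v' : TangentSpace 𝓘(ℝ, E') (0 : ComplexTorus Φ'),
        (∀ y : TangentSpace 𝓘(ℝ, E') (0 : ComplexTorus Φ'),
            ⟪v', y⟫_ℝ = ∑ a, (w' a : ℝ) * Φ'.symm y a) ∧ ‖v'‖ ^ 2 = μ} := by
  have h1 := hiso μ
  rw [finrank_span_eigenforms_eq_ncard_mul_choose Φ g o hg ho h μ,
    finrank_span_eigenforms_eq_ncard_mul_choose Φ' g' o' hg' ho' h μ] at h1
  exact Nat.eq_of_mul_eq_mul_right (Nat.choose_pos (by omega)) h1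

/-- **Remark 3.2 for tori (and its converse there): isospectral on `k₀`-forms for one degree ⇒
isospectral on `k`-forms for every degree** ("if `F = F'` and if one can take `Φ = I`, then
`0`-isospectral implies `p`-isospectral for all `p`"; for tori `F = F' = {1}` and any `k₀ ≤ n` will
do, the multiplicities being `#Λ*_μ · C(n,k₀)`). The hypothesis is in degree `k` (`k + m = n`), the
conclusion in degree `k₂` (`k₂ + m₂ = n`). [cite: MiatelloRossetti2001, Remark 3.2 (p0004 L22–L26)] -/
theorem finrank_span_eigenforms_eq_of_finrank_span_eigenforms_eq (hg : ∀ x y, g.inner x = g.inner y)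
    (ho : letI : RiemannianBundle (fun x : ComplexTorus Φ ↦ TangentSpace 𝓘(ℝ, E) x) :=
        ⟨g.toRiemannianMetric⟩
      IsSmoothForm (riemannianVolumeForm o))
    (hg' : ∀ x y, g'.inner x = g'.inner y)
    (ho' : letI : RiemannianBundle (fun x : ComplexTorus Φ' ↦ TangentSpace 𝓘(ℝ, E') x) :=
        ⟨g'.toRiemannianMetric⟩
      IsSmoothForm (riemannianVolumeForm o')) (h : k + m = n) {k₂ m₂ : ℕ} (h₂ : k₂ + m₂ = n)
    (hiso : letI : RiemannianBundle (fun x : ComplexTorus Φ ↦ TangentSpace 𝓘(ℝ, E) x) :=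
        ⟨g.toRiemannianMetric⟩
      letI : RiemannianBundle (fun x : ComplexTorus Φ' ↦ TangentSpace 𝓘(ℝ, E') x) :=
        ⟨g'.toRiemannianMetric⟩
      ∀ μ : ℝ,
        finrank ℂ (Submodule.span ℂ {β : MForm 𝓘(ℝ, E) (ComplexTorus Φ) ℂ k |
            IsSmoothForm β ∧ cHodgeLaplacian o k m h β = ((4 * Real.pi ^ 2 * μ : ℝ) : ℂ) • β}) =
          finrank ℂ (Submodule.span ℂ {β' : MForm 𝓘(ℝ, E') (ComplexTorus Φ') ℂ k |
            IsSmoothForm β' ∧ cHodgeLaplacian o' k m h β' = ((4 * Real.pi ^ 2 * μ : ℝ) : ℂ) • β'}))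
    (μ : ℝ) :
    letI : RiemannianBundle (fun x : ComplexTorus Φ ↦ TangentSpace 𝓘(ℝ, E) x) :=
      ⟨g.toRiemannianMetric⟩
    letI : RiemannianBundle (fun x : ComplexTorus Φ' ↦ TangentSpace 𝓘(ℝ, E') x) :=
      ⟨g'.toRiemannianMetric⟩
    finrank ℂ (Submodule.span ℂ {β : MForm 𝓘(ℝ, E) (ComplexTorus Φ) ℂ k₂ |
        IsSmoothForm β ∧ cHodgeLaplacian o k₂ m₂ h₂ β = ((4 * Real.pi ^ 2 * μ : ℝ) : ℂ) • β}) =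
      finrank ℂ (Submodule.span ℂ {β' : MForm 𝓘(ℝ, E') (ComplexTorus Φ') ℂ k₂ |
        IsSmoothForm β' ∧ cHodgeLaplacian o' k₂ m₂ h₂ β' = ((4 * Real.pi ^ 2 * μ : ℝ) : ℂ) • β'}) :=
  finrank_span_eigenforms_eq_of_ncard_eq Φ g o Φ' g' o' hg ho hg' ho' h₂
    (ncard_eq_of_finrank_span_eigenforms_eq Φ g o Φ' g' o' hg ho hg' ho' h hiso) μ

end TwoTori

/-! ### §3 Remark 3.3 for the torus: `d_{k,μ} = d_{n-k,μ}`; the bottom `μ = 0` -/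

/-- **Remark 3.3 for the flat torus: `d_{k,μ} = d_{n-k,μ}`** — the multiplicities of `4π²μ` on
`k`-forms and on `(n-k)`-forms coincide ("if `M_Γ` is orientable then `d_{p,μ} = d_{n-p,μ}` for all
`μ`"; here `C(n,k) = C(n,n-k)`, the complementary degree being `m` with `k + m = n`).
[cite: MiatelloRossetti2001, Remark 3.3 (p0004 L28–L31)] -/
theorem finrank_span_eigenforms_eq_finrank_span_eigenforms_of_add_eq
    (hg : ∀ x y, g.inner x = g.inner y)
    (ho : letI : RiemannianBundle (fun x : ComplexTorus Φ ↦ TangentSpace 𝓘(ℝ, E) x) :=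
        ⟨g.toRiemannianMetric⟩
      IsSmoothForm (riemannianVolumeForm o)) (h : k + m = n) (h' : m + k = n) (μ : ℝ) :
    letI : RiemannianBundle (fun x : ComplexTorus Φ ↦ TangentSpace 𝓘(ℝ, E) x) :=
      ⟨g.toRiemannianMetric⟩
    finrank ℂ (Submodule.span ℂ {β : MForm 𝓘(ℝ, E) (ComplexTorus Φ) ℂ k |
        IsSmoothForm β ∧ cHodgeLaplacian o k m h β = ((4 * Real.pi ^ 2 * μ : ℝ) : ℂ) • β}) =
      finrank ℂ (Submodule.span ℂ {γ : MForm 𝓘(ℝ, E) (ComplexTorus Φ) ℂ m |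
        IsSmoothForm γ ∧ cHodgeLaplacian o m k h' γ = ((4 * Real.pi ^ 2 * μ : ℝ) : ℂ) • γ}) := by
  rw [finrank_span_eigenforms_eq_ncard_mul_choose Φ g o hg ho h μ,
    finrank_span_eigenforms_eq_ncard_mul_choose Φ g o hg ho h' μ,
    Nat.choose_symm_of_eq_add h.symm]

/-- **`Λ*_0 = {0}` has exactly one element**: the only `w ∈ ℤ^ι` whose dual-lattice vector has
square norm `0` is `w = 0` (`dualLatticeVec_norm_sq_eq_zero_iff`).
[cite: MiatelloRossetti2001, §3 (p0003 L33)] -/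
theorem ncard_dualLattice_norm_sq_zero :
    letI : RiemannianBundle (fun x : ComplexTorus Φ ↦ TangentSpace 𝓘(ℝ, E) x) :=
      ⟨g.toRiemannianMetric⟩
    Set.ncard {w : ι → ℤ | ∃ v : TangentSpace 𝓘(ℝ, E) (0 : ComplexTorus Φ),
        (∀ y : TangentSpace 𝓘(ℝ, E) (0 : ComplexTorus Φ), ⟪v, y⟫_ℝ = ∑ a, (w a : ℝ) * Φ.symm y a) ∧
          ‖v‖ ^ 2 = 0} = 1 := by
  letI : RiemannianBundle (fun x : ComplexTorus Φ ↦ TangentSpace 𝓘(ℝ, E) x) :=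
    ⟨g.toRiemannianMetric⟩
  rw [Set.ncard_eq_one]
  refine ⟨0, Set.eq_singleton_iff_unique_mem.2 ⟨?_, ?_⟩⟩
  · obtain ⟨v, hv, -⟩ := existsUnique_dualLatticeVec Φ g (0 : ι → ℤ)
    exact ⟨v, hv, (dualLatticeVec_norm_sq_eq_zero_iff Φ g 0 hv).2 rfl⟩
  · rintro w ⟨v, hv, hv0⟩
    exact (dualLatticeVec_norm_sq_eq_zero_iff Φ g w hv).1 hv0

/-- **`d_{k,0}(X) = C(n,k)`**: the `0`-eigenspace of `Δ` on `k`-forms — the harmonic forms, i.e. the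
invariant forms `IFᵏ(X)` (`eq_constForm_of_cHodgeLaplacian_eq_zero`, `ComplexTorusHarmonicForms.lean`)
— has dimension `C(n,k)`, `n = dim_ℝ X` (Theorem 3.1 at `μ = 0`, `#Λ*_0 = 1`; validation of the
multiplicity formula). [cite: MiatelloRossetti2001, Thm. 3.1 and Remark 3.4 (p0004)] -/
theorem finrank_span_eigenforms_zero_right (hg : ∀ x y, g.inner x = g.inner y)
    (ho : letI : RiemannianBundle (fun x : ComplexTorus Φ ↦ TangentSpace 𝓘(ℝ, E) x) :=
        ⟨g.toRiemannianMetric⟩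
      IsSmoothForm (riemannianVolumeForm o)) (h : k + m = n) :
    letI : RiemannianBundle (fun x : ComplexTorus Φ ↦ TangentSpace 𝓘(ℝ, E) x) :=
      ⟨g.toRiemannianMetric⟩
    finrank ℂ (Submodule.span ℂ {β : MForm 𝓘(ℝ, E) (ComplexTorus Φ) ℂ k |
        IsSmoothForm β ∧ cHodgeLaplacian o k m h β = ((4 * Real.pi ^ 2 * 0 : ℝ) : ℂ) • β}) =
      n.choose k := by
  rw [finrank_span_eigenforms_eq_ncard_mul_choose Φ g o hg ho h 0, ncard_dualLattice_norm_sq_zero Φ g,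
    one_mul]

end ComplexTorus

end Literature.Geometry.Kaehler
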